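import Summits.CriticalPhenomena.PercolationContinuityZ3.Theorems.PercShatteringRaceNearLinearTwoClusterDecayPointToPoint
import Summits.CriticalPhenomena.PercolationContinuityZ3.Theorems.PercShatteringRaceNearLinearTwoClusterDecayStubAspectOfTwoArmBdryWide
import Summits.CriticalPhenomena.PercolationContinuityZ3.Theorems.PercShatteringRaceNearLinearTwoClusterDecayStubPairAspectOfTwoArmWide
import Summits.CriticalPhenomena.PercolationContinuityZ3.Theorems.PercShatteringRaceNearLinearTwoClusterDecayPairFrontier
import HarnessLib

/-!
# Crux `PercShatteringRace.NearLinearTwoClusterDecay` (stmt-CriticalPhenomena-5785) — the unconditional frontier with `e = 9`: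
# two-cluster decay at every aspect exponent `A ≥ 38` (union form) and `A ≥ 30` (pair form) at `p_c(ℤ³)`

Certificate file of the line `pair-decay-long-arms-dense` (lead c13); lands with `--supports stmt-CriticalPhenomena-5785`.
The crux is `AtExponent (7/6)` (`Negative.nearLinearTwoClusterDecay_iff`, `Iff.rfl`); the tree knew `AtExponent A` for every
`A ≥ 44` (`CritFrontier.critAtExponent_of_ge_44`, p146707) and the pair form for every `A ≥ 36` (`PairFrontier.critPairDecay_of_ge_36`,
p152370), both from Cerf's pair-connection input `e = 12` (Lemma 6.1, W1/W4).  With van den Berg–Don's `e = 9`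
(`Theorems.critPairConnLower9`, `…PointToPoint.lean`) in the wide lossy steps `Theorems.stub_aspectOfTwoArmBdryWide` (p162963,
`κA > 10 + e`) and `Theorems.stub_pairAspectOfTwoArmWide` (p164020, `κA > 6 + e`):

* `critAtExponent_of_gt_38` — AKN exponent `κ = (1/2 + 19/A)/2 < 1/2`: `AtExponent A` for every `A > 38`;
* `critAtExponent_of_ge_38` — with bond Cerf Thm 1.1 at `p_c` (W2, `κ₀ > 1/2`): every `A ≥ 38`;
* `critPairDecay_of_gt_30` / `critPairDecay_of_ge_30` — the pair form for every `A > 30` / `A ≥ 30`;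
* `atExponent_status_38` — the status line for the planner: fails at every `A ≤ 1`, holds at every `A ≥ 38`, pair form at every
  `A ≥ 30`, crux = instance `7/6`.

HONEST SCOPE (STRATEGY-CENSUS s1 §6): exponent bookkeeping inside the AKN/Cerf counting class (floor ≈ 5, AKN-count-budget-c6) — the
formal frontier of the crux family and the record of the best published inputs, not progress toward `7/6`; the two children of the line
(`PairTwoArmsDecay` in the jump world, `LongArmsAreDense`) are untouched.

## References

* J. van den Berg, H. Don, Electron. Commun. Probab. 25 (2020) no. 47, Cor. 2 and Remark (iii) [VandenbergDon2020].
* R. Cerf, Ann. Probab. 43 (2015) 2458–2480, Thm 1.1, Thm 1.2, Lemma 7.1, Cor 7.3 [Cerf2015].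
* M. Aizenman, H. Kesten, C. Newman, Comm. Math. Phys. 111 (1987) 505–531 (two-arms exponent `≥ 1/2`) [AizenmanKestenNewman1987].
-/

noncomputable section

namespace Summit.CriticalPhenomena.PercolationContinuityZ3.Theorems

namespace NearLinearTwoClusterDecay.CritFrontier38

open MeasureTheory Filter Topology
open Literature.Probability.LatticeModels Literature.Probability.Percolation
open Summit.CriticalPhenomena.PercolationContinuityZ3.Theorems.NearLinearTwoClusterDecay.Negative
open Summit.CriticalPhenomena.PercolationContinuityZ3.Theorems.NearLinearTwoClusterDecay.CritFrontier

/-- **At `p_c`: `AtExponent A` for every `A > 38`, unconditionally** — van den Berg–Don's `e = 9` (`critPairConnLower9`) in the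
wide boundary-pair lossy step (`stub_aspectOfTwoArmBdryWide`, `κA > 10 + 9`) with the AKN exponent `κ = (1/2 + 19/A)/2 < 1/2`
(`κA = A/4 + 19/2 > 19`). [cite: VandenbergDon2020, Remark (iii)] -/
theorem critAtExponent_of_gt_38 {A : ℝ} (hA : 38 < A) : AtExponent A := by
  have hp0 : 0 < ((criticalProbI 3 : unitInterval) : ℝ) := by rw [coe_criticalProbI]; exact criticalProb_three_pos_lt_one.1
  have hp1 : ((criticalProbI 3 : unitInterval) : ℝ) < 1 := by rw [coe_criticalProbI]; exact criticalProb_three_pos_lt_one.2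
  have hA0 : 0 < A := by linarith
  set κ : ℝ := (1 / 2 + 19 / A) / 2 with hκ
  have h19A : 19 / A < 1 / 2 := by rw [div_lt_iff₀ hA0]; linarith
  have hκlt : κ < 1 / 2 := by rw [hκ]; linarith
  have hκ0 : 0 < κ := by rw [hκ]; positivity
  have hκA : 10 + 9 < κ * A := by
    have : κ * A = A / 4 + 19 / 2 := by rw [hκ]; field_simp; ring
    rw [this]; linarith
  exact stub_aspectOfTwoArmBdryWide (criticalProbI 3) hp0 9 (by norm_num) critPairConnLower9 κ hκ0
    (twoArm_of_lt_half_at (criticalProbI 3) hp0 hp1 hκlt) A (by linarith) hκA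

/-- **At `p_c` the threshold is at most `38`**: with bond Cerf Thm 1.1 at `p_c` (W2: some two-arms exponent `κ₀ > 1/2`) the
condition `κ₀ A > 19` holds at `A = 38` itself (`38 κ₀ > 19`), so `AtExponent A` for every `A ≥ 38` with no monotonicity argument.
[cite: Cerf2015, Thm 1.1] -/
theorem critAtExponent_of_ge_38 {A : ℝ} (hA : 38 ≤ A) : AtExponent A := by
  obtain ⟨κ₀, hκ₀, hT⟩ := stub_critTwoArmImproved stub_critPairConnLower
  have hκ0 : 0 < κ₀ := by linarith
  have hp0 : 0 < ((criticalProbI 3 : unitInterval) : ℝ) := by rw [coe_criticalProbI]; exact criticalProb_three_pos_lt_one.1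
  have hκA : 10 + 9 < κ₀ * A := by nlinarith
  exact stub_aspectOfTwoArmBdryWide (criticalProbI 3) hp0 9 (by norm_num) critPairConnLower9 κ₀ hκ0 hT A (by linarith) hκA

/-- **At `p_c` the threshold is STRICTLY below `38`** (W2: `κ₀ > 1/2`; `A = (19/κ₀ + 38)/2 < 38`). [cite: Cerf2015, Thm 1.1] -/
theorem exists_critAtExponent_lt_38 : ∃ A : ℝ, A < 38 ∧ AtExponent A := by
  obtain ⟨κ₀, hκ₀, hT⟩ := stub_critTwoArmImproved stub_critPairConnLower
  have hκ0 : 0 < κ₀ := by linarith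
  have h19 : 19 / κ₀ < 38 := by rw [div_lt_iff₀ hκ0]; linarith
  have h0 : 0 < 19 / κ₀ := by positivity
  have hp0 : 0 < ((criticalProbI 3 : unitInterval) : ℝ) := by rw [coe_criticalProbI]; exact criticalProb_three_pos_lt_one.1
  refine ⟨(19 / κ₀ + 38) / 2, by linarith, ?_⟩
  refine stub_aspectOfTwoArmBdryWide (criticalProbI 3) hp0 9 (by norm_num) critPairConnLower9 κ₀ hκ0 hT _ (by linarith) ?_
  have : κ₀ * ((19 / κ₀ + 38) / 2) = 19 / 2 + 19 * κ₀ := by field_simp; ring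
  rw [this]; linarith

/-- **At `p_c`: pair-form two-cluster decay at every exponent `A > 30`, unconditionally** — `e = 9` in the wide pair lossy step
(`stub_pairAspectOfTwoArmWide`, `κA > 6 + 9`) with the AKN exponent `κ = (1/2 + 15/A)/2 < 1/2` (`κA = A/4 + 15/2 > 15`).
[cite: VandenbergDon2020, Remark (iii)] -/
theorem critPairDecay_of_gt_30 {A : ℝ} (hA : 30 < A) :
    ∀ ε : ℝ, 0 < ε → ∀ᶠ n : ℕ in atTop, ∀ x ∈ box 3 n, ∀ x' ∈ box 3 n,
      (bondPercolation (zdGraph 3) (criticalProbI 3)).real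
        {ω | ∃ y ∈ innerBoundary (zdGraph 3) (box 3 ⌈(n : ℝ) ^ A⌉₊),
          ∃ y' ∈ innerBoundary (zdGraph 3) (box 3 ⌈(n : ℝ) ^ A⌉₊),
            ω ∈ openConnIn ↑(box 3 ⌈(n : ℝ) ^ A⌉₊) x y ∧
            ω ∈ openConnIn ↑(box 3 ⌈(n : ℝ) ^ A⌉₊) x' y' ∧
            ω ∉ openConnIn ↑(box 3 ⌈(n : ℝ) ^ A⌉₊) x x'} ≤ ε := by
  have hp0 : 0 < ((criticalProbI 3 : unitInterval) : ℝ) := by rw [coe_criticalProbI]; exact criticalProb_three_pos_lt_one.1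
  have hp1 : ((criticalProbI 3 : unitInterval) : ℝ) < 1 := by rw [coe_criticalProbI]; exact criticalProb_three_pos_lt_one.2
  have hA0 : 0 < A := by linarith
  set κ : ℝ := (1 / 2 + 15 / A) / 2 with hκ
  have h15A : 15 / A < 1 / 2 := by rw [div_lt_iff₀ hA0]; linarith
  have hκlt : κ < 1 / 2 := by rw [hκ]; linarith
  have hκ0 : 0 < κ := by rw [hκ]; positivity
  have hκA : 6 + 9 < κ * A := by
    have : κ * A = A / 4 + 15 / 2 := by rw [hκ]; field_simp; ring
    rw [this]; linarith
  exact stub_pairAspectOfTwoArmWide (criticalProbI 3) hp0 9 (by norm_num) critPairConnLower9 κ hκ0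
    (twoArm_of_lt_half_at (criticalProbI 3) hp0 hp1 hκlt) A (by linarith) hκA

/-- **At `p_c`: pair-form decay at every exponent `A ≥ 30`** (W2: `κ₀ > 1/2` gives `κ₀ A ≥ 30 κ₀ > 15`). [cite: Cerf2015, Thm 1.1 and Lemma 7.1] -/
theorem critPairDecay_of_ge_30 :
    ∀ A : ℝ, 30 ≤ A → ∀ ε : ℝ, 0 < ε → ∀ᶠ n : ℕ in atTop, ∀ x ∈ box 3 n, ∀ x' ∈ box 3 n,
      (bondPercolation (zdGraph 3) (criticalProbI 3)).real
        {ω | ∃ y ∈ innerBoundary (zdGraph 3) (box 3 ⌈(n : ℝ) ^ A⌉₊),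
          ∃ y' ∈ innerBoundary (zdGraph 3) (box 3 ⌈(n : ℝ) ^ A⌉₊),
            ω ∈ openConnIn ↑(box 3 ⌈(n : ℝ) ^ A⌉₊) x y ∧
            ω ∈ openConnIn ↑(box 3 ⌈(n : ℝ) ^ A⌉₊) x' y' ∧
            ω ∉ openConnIn ↑(box 3 ⌈(n : ℝ) ^ A⌉₊) x x'} ≤ ε := by
  intro A hA
  obtain ⟨κ₀, hκ₀, hT⟩ := stub_critTwoArmImproved stub_critPairConnLower
  have hκ0 : 0 < κ₀ := by linarith
  have hp0 : 0 < ((criticalProbI 3 : unitInterval) : ℝ) := by rw [coe_criticalProbI]; exact criticalProb_three_pos_lt_one.1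
  have hκA : 6 + 9 < κ₀ * A := by nlinarith
  exact stub_pairAspectOfTwoArmWide (criticalProbI 3) hp0 9 (by norm_num) critPairConnLower9 κ₀ hκ0 hT A (by linarith) hκA

/-- **Status of the crux family at `p_c` after § V (for the planner; all inputs LANDED)**: decay fails at every exponent `≤ 1`
(`Negative.not_atExponent_of_le_one`), holds at every exponent `≥ 38` (union form, this file; previously `44`) and at some
exponent `< 38`, the pair form at every exponent `≥ 30` (previously `36`); the crux is the instance `7/6`, so its open content is
the aspect reduction `38 → 7/6` (child 1 in the jump world, child 2 `LongArmsAreDense`). [folklore] -/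
theorem atExponent_status_38 :
    (∀ A : ℝ, A ≤ 1 → ¬ NearLinearTwoClusterDecay.Negative.AtExponent A) ∧ (∀ A : ℝ, 38 ≤ A → NearLinearTwoClusterDecay.Negative.AtExponent A) ∧ (∃ A : ℝ, A < 38 ∧ NearLinearTwoClusterDecay.Negative.AtExponent A) ∧ (∀ A : ℝ, 30 ≤ A → ∀ ε : ℝ, 0 < ε → ∀ᶠ n : ℕ in atTop, ∀ x ∈ box 3 n, ∀ x' ∈ box 3 n, (bondPercolation (zdGraph 3) (criticalProbI 3)).real {ω | ∃ y ∈ innerBoundary (zdGraph 3) (box 3 ⌈(n : ℝ) ^ A⌉₊), ∃ y' ∈ innerBoundary (zdGraph 3) (box 3 ⌈(n : ℝ) ^ A⌉₊), ω ∈ openConnIn ↑(box 3 ⌈(n : ℝ) ^ A⌉₊) x y ∧ ω ∈ openConnIn ↑(box 3 ⌈(n : ℝ) ^ A⌉₊) x' y' ∧ ω ∉ openConnIn ↑(box 3 ⌈(n : ℝ) ^ A⌉₊) x x'} ≤ ε) ∧ (Summit.CriticalPhenomena.PercolationContinuityZ3.Theses.PercShatteringRace.NearLinearTwoClusterDecay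 ↔ NearLinearTwoClusterDecay.Negative.AtExponent ((7 : ℝ) / 6)) :=
  ⟨fun _ hA => not_atExponent_of_le_one hA, fun _ hA => critAtExponent_of_ge_38 hA, exists_critAtExponent_lt_38,
    critPairDecay_of_ge_30, Iff.rfl⟩

end NearLinearTwoClusterDecay.CritFrontier38

end Summit.CriticalPhenomena.PercolationContinuityZ3.Theorems

end
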